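import Summits.AnomalousDissipation.AnomalousDissipation.Theorems.SawtoothPulseCascadeK1LocalisedCascadeKHTransportParseval
import Summits.AnomalousDissipation.AnomalousDissipation.Theorems.SawtoothPulseCascadeK1LocalisedCascadeKHTransportCoeff
import Summits.AnomalousDissipation.AnomalousDissipation.Theorems.SawtoothPulseCascadeK1LocalisedCascadeKHStraightPairEnergy

/-!
# K2 lane (route-2 `SawtoothPulseCascade`, crux dir `K1LocalisedCascade`): TRANSPORT LOCALITY IN ENERGY FORM — the windowed energy of ONE transported sheet row, column by column (sub-lemma L-i-b of the E6 far-row schema, A27-7; `Cruxes/K1LocalisedCascade/K2FarRowsR1-p2.md` §6, §9)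

Helper file of the K2 lane (ACL item stmt-AnomalousDissipation-19491). In p4's `vTransport` (crux copy of `K2ConeSketch`), a sheet row of streamwise
wavenumber `ξ = α′+m` is multiplied, in column `b = β′+n`, by the transport phase `e^{−2πibθ·tri(x)}` and re-expanded: its coefficient on the output row
`ξ′ = α′+m′` is the transport coefficient `τ(b,θ; ξ→ξ′) = ∫_{−½}^{½} e^{2πiξx} e^{−2πibθ·tri(x)} e^{−2πiξ′x} dx` (tree `transport_coeff_eq`, p705068: two sinc
lobes at the images `ξ′ = ξ ± bθ`, tails `‖τ‖ ≤ 4/|Λ₊| + 2/|Λ₋|`, `Λ± = 2π(ξ−ξ′±bθ)`), and the column's windowed energy is `Σ_{|m′| ≤ K} ‖τ‖²/((α′+m′)² + b²)`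
(× `1/(4π²4^ℓ)`). This file proves the SPLIT BOUND every far entry needs (`transport_column_energy_le`): for any threshold `R ≥ 0` and gap `D > 0` with
`R + D ≤ |ξ ± bθ|` (both images at least `R + D` away from the origin),

  `Σ_{|m′| ≤ K} ‖τ(b,θ; ξ→α′+m′)‖²/((α′+m′)² + b²) ≤ 1/(R² + b²) + (3/(πD))²·(π/|b| + 2/b²)`

— BULK (`|α′+m′| ≥ R`): weight `≤ 1/(R²+b²)` times the total mass `Σ_{m′}‖τ‖² ≤ ∫|e^{…}|² = 1` (Parseval, tree `hasSum_sq_coeff`, p703912); TAIL (`|α′+m′| < R`):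
`‖τ‖² ≤ (3/(πD))²` (sinc tails, both `|Λ±| ≥ 2πD`) times the window weight sum `≤ π/|b| + 2/b²` (tree `window_weight_sum_upper`, p707331; class offset
`α′ ∈ [0,1]`). The choice of `R, D` per column (e.g. `R = |ξ|/2`, `D = |ξ|/4` for `|bθ| ≤ |ξ|/4`) and the column sum are left to the assembly. No definitions;
nothing about the crux by name. [cite: ElgindiLissMattingly2025, §1 (H_α, V_α)] [problem: turb]
-/

-- `Summit.<Summit>.<Problem>`: single-conjunct summit, the duplicate namespace segment is deliberate.
set_option linter.dupNamespace false

noncomputable section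

namespace Summit.AnomalousDissipation.AnomalousDissipation.Theorems.SawtoothPulseCascade.K2PhaseBudget

open Finset MeasureTheory intervalIntegral Literature.Analysis.FluidPDE.SawtoothCascade

/-- The transported row mode `x ↦ e^{2πiξx}·e^{−2πibθ·tri(x)}` is continuous and unimodular. [cite: ElgindiLissMattingly2025, §1 (H_α, V_α)] -/
theorem continuous_transportedMode (b θ ξ : ℝ) :
    Continuous fun y : ℝ => Complex.exp (((2 * Real.pi * ξ * y : ℝ) : ℂ) * Complex.I) *
      Complex.exp (-((2 * Real.pi * b * θ * triWave y : ℝ) : ℂ) * Complex.I) := by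
  have := continuous_triWave'
  fun_prop

/-- `‖e^{2πiξx}·e^{−2πibθ·tri(x)}‖ = 1`. [folklore] -/
theorem norm_transportedMode (b θ ξ y : ℝ) :
    ‖Complex.exp (((2 * Real.pi * ξ * y : ℝ) : ℂ) * Complex.I) * Complex.exp (-((2 * Real.pi * b * θ * triWave y : ℝ) : ℂ) * Complex.I)‖ = 1 := by
  rw [norm_mul, Complex.norm_exp_ofReal_mul_I,
    show -((2 * Real.pi * b * θ * triWave y : ℝ) : ℂ) * Complex.I = ((-(2 * Real.pi * b * θ * triWave y) : ℝ) : ℂ) * Complex.I by push_cast; ring,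
    Complex.norm_exp_ofReal_mul_I, mul_one]

/-- **Total mass of the transported row is `≤ 1` on every window** (Parseval: `Σ_{m′∈ℤ} ‖τ(b,θ;ξ→α′+m′)‖² = ∫|e^{…}|² = 1`). [folklore] -/
theorem sum_sq_transport_coeff_le_one (b θ ξ α' : ℝ) (S : Finset ℤ) :
    ∑ m' ∈ S, ‖∫ y in (-(1 / 2 : ℝ))..(1 / 2 : ℝ), Complex.exp (((2 * Real.pi * ξ * y : ℝ) : ℂ) * Complex.I) *
        Complex.exp (-((2 * Real.pi * b * θ * triWave y : ℝ) : ℂ) * Complex.I) * Complex.exp (-((2 * Real.pi * (α' + m') * y : ℝ) : ℂ) * Complex.I)‖ ^ 2 ≤ 1 := by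
  have hP := hasSum_sq_coeff (continuous_transportedMode b θ ξ) α'
  have h1 : (∫ y in (-(1 / 2 : ℝ))..(1 / 2), ‖Complex.exp (((2 * Real.pi * ξ * y : ℝ) : ℂ) * Complex.I) *
      Complex.exp (-((2 * Real.pi * b * θ * triWave y : ℝ) : ℂ) * Complex.I)‖ ^ 2) = 1 := by
    simp_rw [norm_transportedMode, one_pow]
    rw [intervalIntegral.integral_const, smul_eq_mul, mul_one]
    norm_num
  rw [h1] at hP
  exact sum_le_hasSum S (fun n _ => by positivity) hP

/-- **L-i-b, ONE ROW, ONE COLUMN (split bound).** For a class offset `α′ ∈ [0,1]`, a column `b ≠ 0`, strain `θ`, source row `ξ`, window `K`, and any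
threshold `R ≥ 0` and gap `D > 0` with `R + D ≤ |ξ + bθ|` and `R + D ≤ |ξ − bθ|`:
`Σ_{|m′| ≤ K} ‖τ(b,θ; ξ→α′+m′)‖²/((α′+m′)² + b²) ≤ 1/(R² + b²) + (3/(πD))²·(π/|b| + 2/b²)`. [cite: ElgindiLissMattingly2025, §1 (H_α, V_α)] -/
theorem transport_column_energy_le {α' : ℝ} (hα0 : 0 ≤ α') (hα1 : α' ≤ 1) {b : ℝ} (hb : b ≠ 0) (θ ξ : ℝ) (K : ℕ) {R D : ℝ} (hR : 0 ≤ R)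
    (hD : 0 < D) (hDp : R + D ≤ |ξ + b * θ|) (hDm : R + D ≤ |ξ - b * θ|) :
    ∑ m' ∈ Icc (-(K : ℤ)) K, ‖∫ y in (-(1 / 2 : ℝ))..(1 / 2 : ℝ), Complex.exp (((2 * Real.pi * ξ * y : ℝ) : ℂ) * Complex.I) *
        Complex.exp (-((2 * Real.pi * b * θ * triWave y : ℝ) : ℂ) * Complex.I) * Complex.exp (-((2 * Real.pi * (α' + m') * y : ℝ) : ℂ) * Complex.I)‖ ^ 2 /
          ((α' + m') ^ 2 + b ^ 2) ≤ 1 / (R ^ 2 + b ^ 2) + (3 / (Real.pi * D)) ^ 2 * (Real.pi / |b| + 2 / b ^ 2) := by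
  set τ : ℤ → ℂ := fun m' => ∫ y in (-(1 / 2 : ℝ))..(1 / 2 : ℝ), Complex.exp (((2 * Real.pi * ξ * y : ℝ) : ℂ) * Complex.I) *
        Complex.exp (-((2 * Real.pi * b * θ * triWave y : ℝ) : ℂ) * Complex.I) * Complex.exp (-((2 * Real.pi * (α' + m') * y : ℝ) : ℂ) * Complex.I) with hτ
  have hb0 : 0 < |b| := abs_pos.2 hb
  have hb2 : 0 < b ^ 2 := by positivity
  -- split the window at `|α' + m'| ≥ R`
  rw [← sum_filter_add_sum_filter_not (Icc (-(K : ℤ)) K) (fun m' : ℤ => R ≤ |α' + (m' : ℝ)|)]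
  -- BULK
  have hA : ∑ m' ∈ (Icc (-(K : ℤ)) K).filter (fun m' : ℤ => R ≤ |α' + (m' : ℝ)|), ‖τ m'‖ ^ 2 / ((α' + m') ^ 2 + b ^ 2) ≤ 1 / (R ^ 2 + b ^ 2) := by
    have h1 : ∀ m' ∈ (Icc (-(K : ℤ)) K).filter (fun m' : ℤ => R ≤ |α' + (m' : ℝ)|),
        ‖τ m'‖ ^ 2 / ((α' + m') ^ 2 + b ^ 2) ≤ ‖τ m'‖ ^ 2 * (1 / (R ^ 2 + b ^ 2)) := by
      intro m' hm'
      have hRm : R ≤ |α' + (m' : ℝ)| := (mem_filter.1 hm').2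
      rw [div_eq_mul_one_div]
      refine mul_le_mul_of_nonneg_left (div_le_div_of_nonneg_left zero_le_one (by positivity) ?_) (sq_nonneg _)
      nlinarith [sq_abs (α' + (m' : ℝ)), mul_le_mul hRm hRm hR (abs_nonneg _)]
    refine (sum_le_sum h1).trans ?_
    rw [← sum_mul]
    have hmass := sum_sq_transport_coeff_le_one b θ ξ α' ((Icc (-(K : ℤ)) K).filter (fun m' : ℤ => R ≤ |α' + (m' : ℝ)|))
    have hw : 0 ≤ 1 / (R ^ 2 + b ^ 2) := by positivity
    calc (∑ m' ∈ (Icc (-(K : ℤ)) K).filter (fun m' : ℤ => R ≤ |α' + (m' : ℝ)|), ‖τ m'‖ ^ 2) * (1 / (R ^ 2 + b ^ 2))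
        ≤ 1 * (1 / (R ^ 2 + b ^ 2)) := mul_le_mul_of_nonneg_right hmass hw
      _ = 1 / (R ^ 2 + b ^ 2) := one_mul _
  -- TAIL
  have hB : ∑ m' ∈ (Icc (-(K : ℤ)) K).filter (fun m' : ℤ => ¬ R ≤ |α' + (m' : ℝ)|), ‖τ m'‖ ^ 2 / ((α' + m') ^ 2 + b ^ 2) ≤
      (3 / (Real.pi * D)) ^ 2 * (Real.pi / |b| + 2 / b ^ 2) := by
    have h1 : ∀ m' ∈ (Icc (-(K : ℤ)) K).filter (fun m' : ℤ => ¬ R ≤ |α' + (m' : ℝ)|),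
        ‖τ m'‖ ^ 2 / ((α' + m') ^ 2 + b ^ 2) ≤ (3 / (Real.pi * D)) ^ 2 * (((α' + m') ^ 2 + b ^ 2)⁻¹ : ℝ) := by
      intro m' hm'
      have hRm : |α' + (m' : ℝ)| < R := not_le.1 (mem_filter.1 hm').2
      have hp' : D ≤ |ξ - (α' + m') + b * θ| := by
        have := abs_sub_abs_le_abs_sub (ξ + b * θ) (α' + m')
        rw [show ξ + b * θ - (α' + ↑m') = ξ - (α' + m') + b * θ by ring] at this
        linarith
      have hm'' : D ≤ |ξ - (α' + m') - b * θ| := by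
        have := abs_sub_abs_le_abs_sub (ξ - b * θ) (α' + m')
        rw [show ξ - b * θ - (α' + ↑m') = ξ - (α' + m') - b * θ by ring] at this
        linarith
      have hp : 2 * Real.pi * (ξ - (α' + m') + b * θ) ≠ 0 := by
        intro h
        have : ξ - (α' + m') + b * θ = 0 := by nlinarith [Real.pi_pos]
        rw [this, abs_zero] at hp'
        linarith
      have hm : 2 * Real.pi * (ξ - (α' + m') - b * θ) ≠ 0 := by
        intro h
        have : ξ - (α' + m') - b * θ = 0 := by nlinarith [Real.pi_pos]
        rw [this, abs_zero] at hm''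
        linarith
      have hτle : ‖τ m'‖ ≤ 3 / (Real.pi * D) := by
        refine (norm_transport_coeff_le b θ ξ (α' + m') hp hm).trans ?_
        rw [abs_mul (2 * Real.pi), abs_mul (2 * Real.pi), abs_of_pos (by positivity : (0 : ℝ) < 2 * Real.pi)]
        have e1 : 4 / (2 * Real.pi * |ξ - (α' + ↑m') + b * θ|) ≤ 4 / (2 * Real.pi * D) :=
          div_le_div_of_nonneg_left (by norm_num) (by positivity) (by nlinarith [Real.pi_pos])
        have e2 : 2 / (2 * Real.pi * |ξ - (α' + ↑m') - b * θ|) ≤ 2 / (2 * Real.pi * D) :=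
          div_le_div_of_nonneg_left (by norm_num) (by positivity) (by nlinarith [Real.pi_pos])
        have e3 : 4 / (2 * Real.pi * D) + 2 / (2 * Real.pi * D) = 3 / (Real.pi * D) := by
          field_simp; ring
        linarith
      rw [div_eq_mul_inv]
      refine mul_le_mul_of_nonneg_right ?_ (by positivity)
      exact pow_le_pow_left₀ (norm_nonneg _) hτle 2
    refine (sum_le_sum h1).trans ?_
    rw [← mul_sum]
    refine mul_le_mul_of_nonneg_left ?_ (by positivity)
    have hW := window_weight_sum_upper hα0 hα1 hb0 K
    rw [sq_abs] at hW
    refine le_trans ?_ hW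
    refine sum_le_sum_of_subset_of_nonneg (filter_subset _ _) fun m' _ _ => by positivity
  exact add_le_add hA hB

end Summit.AnomalousDissipation.AnomalousDissipation.Theorems.SawtoothPulseCascade.K2PhaseBudget
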